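import Summits.ABC.ABC.Theses.CubicResolventAllowance
import Summits.ABC.ABC.Theorems.CubicResolventAllowanceResolventDiscBounds
import Literature.NumberTheory.CubicFields.CubicFieldForms
import Literature.NumberTheory.CubicFields.BinaryCubicForms
import Mathlib.NumberTheory.Padics.Complex
import HarnessLib

/-!
# Stub-ideation k=2 (RESHAPE), GEN 6 — `stub_realCubic` of crux `IndexSzpiro` (stmt-ABC-22740)

Scratch companion of `STUB-IDEAS-stub_realCubic-2.md` (gen 6).  Only the NEW statements of gen 6 are
typed here (gens 2–5: `StubIdeas2Sketch.lean`, `StubIdeas2RealG4Sketch.lean`, `StubIdeas2RealG5Sketch.lean`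
in `Cruxes/IndexSzpiro/`).  `sorry` = proposed helper lemma.

* §U  quantifier surgery on the constant: the allowance exponent `1 + ε` is free (U1).
* §H  HEIGHT SURGERY (B–G 6.5.7): reduced index forms have height `≤ poly(d_K)` (H1); quantitative
  Roth–Ridout with `S = {∞} ∪ S₀`: solutions of height `> (2·H(F))^E` number `≤ N₀(δ, |S₀|)` (H2, named
  fact); the allowance `d_K ≤ 1944 N²` (landed `resolventDiscBounds_proof`) turns "small" into
  polynomial Szpiro (H4); assembled: A-PS on each deep-support cell off `≤ N₁(s)` exceptional
  `j`-invariants per `(K, S)` (RUNG `CellPolySzpiroOffLarge`).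
-/

noncomputable section

open scoped Classical
open Polynomial NumberField WeierstrassCurve Finset
open Literature.NumberTheory.CubicFields Literature.NumberTheory.CubicFields.BinaryCubic

namespace Summit.ABC.ABC.Cruxes.IndexSzpiro.StubIdeas2RealG6

/-- The stub, verbatim (registered skeleton, `stub_realCubic`). -/
def StubRealCubic : Prop :=
  ∀ ε : ℝ, 0 < ε → ∃ C : ℝ, ∀ (W : WeierstrassCurve ℚ) [W.IsElliptic] (K : Type) [Field K] [NumberField K],
    Irreducible W.twoTorsionPolynomial.toPoly → Module.finrank ℚ K = 3 →
    (∃ θ : K, aeval θ W.twoTorsionPolynomial.toPoly = 0) → 0 < NumberField.discr K →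
    (W.minimalDiscriminantNorm ℤ : ℝ) ≤ C * |(NumberField.discr K : ℝ)| * (W.conductorNorm ℤ : ℝ) ^ (6 + ε)

/-! ## §U  Quantifier surgery: which uniformity in `K` is free -/

/-- U1-def. The stub with the LOOSE allowance `|d_K|^{1+ε}`. -/
def StubRealLoose : Prop :=
  ∀ ε : ℝ, 0 < ε → ∃ C : ℝ, ∀ (W : WeierstrassCurve ℚ) [W.IsElliptic] (K : Type) [Field K] [NumberField K],
    Irreducible W.twoTorsionPolynomial.toPoly → Module.finrank ℚ K = 3 →
    (∃ θ : K, aeval θ W.twoTorsionPolynomial.toPoly = 0) → 0 < NumberField.discr K →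
    (W.minimalDiscriminantNorm ℤ : ℝ) ≤
      C * |(NumberField.discr K : ℝ)| ^ (1 + ε) * (W.conductorNorm ℤ : ℝ) ^ (6 + ε)

/-- U1 (S). `StubRealCubic ↔ StubRealLoose`: `→` since `|d_K| ≥ 1`; `←` with `ε/4` and the landed
allowance bound `|d_K| ≤ 1944·N²` (`Summit.ABC.ABC.Theorems.resolventDiscBounds_proof`):
`|d_K|^{1+ε/4} N^{6+ε/4} ≤ 1944^{ε/4} |d_K| N^{6+3ε/4}`.  Reading: the per-field constant may grow like
`|d_K|^{o(1)}` (equivalently `H(F_K)^{o(1)}`, H1) for free — and no faster. -/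
theorem stubReal_iff_loose : StubRealCubic ↔ StubRealLoose := by
  sorry

/-! ## §H  Height surgery (small / large solutions, Bombieri–Gubler 6.5.7) -/

/-- Naive height of an integral binary cubic form. -/
def formHeight (F : BinaryCubic ℤ) : ℤ := max (max |F.a| |F.b|) (max |F.c| |F.d|)

/-- The Hessian coefficients `P = b² − 3ac`, `Q = bc − 9ad`, `R = c² − 3bd` (= `BinaryCubic.hessP/Q/R` of
`Literature.NumberTheory.CubicFields.HessianCovariant`, spelled out here only because that module's import chain
(`MaximalDiscriminantValuation → SingularZeroModP`) was unbuilt on the farm snapshot when this sketch was checked). -/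
def hP (F : BinaryCubic ℤ) : ℤ := F.b ^ 2 - 3 * F.a * F.c
/-- see `hP`. -/
def hQ (F : BinaryCubic ℤ) : ℤ := F.b * F.c - 9 * F.a * F.d
/-- see `hP`. -/
def hR (F : BinaryCubic ℤ) : ℤ := F.c ^ 2 - 3 * F.b * F.d

/-- H1 (M). Every totally real cubic field has an index form (`RingOfForm F ≃+* 𝓞 K`, so
`disc F = d_K`) that is Hessian-reduced, hence of height `≤ c·d_K` (in fact `≪ d_K^{3/4}`):
`exists_ringOfForm_ringEquiv_ringOfIntegers` + `exists_gl2zEquiv_hessianReduced` +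
`sq_a_le_of_reduced`, `sq_b_le_of_reduced`, `hessP_sq_le_disc` (`|a|,|b| ≪ d^{1/4}`) and
`|bc − 9ad| ≤ P ≤ √d`, `c² − 3bd = R ≤ (P² + 3d)/(4P)` for `c, d`. [cite: Davenport1951CubicFormsI, Lemma 1] -/
theorem exists_reduced_indexForm_height_le :
    ∃ c : ℝ, ∀ (K : Type) [Field K] [NumberField K], Module.finrank ℚ K = 3 → 0 < NumberField.discr K →
      ∃ F : BinaryCubic ℤ, Nonempty (RingOfForm F ≃+* 𝓞 K) ∧ F.disc = NumberField.discr K ∧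
        |hQ F| ≤ hP F ∧ hP F ≤ hR F ∧ (formHeight F : ℝ) ≤ c * (NumberField.discr K : ℝ) := by
  sorry

/-- Multiplicative height of a rational number. -/
def ratHeight (ρ : ℚ) : ℝ := max (|ρ.num| : ℝ) (ρ.den : ℝ)

/-- H2 (L, LITERATURE named fact). **Quantitative Roth–Ridout over `ℚ`, `S = {∞} ∪ S₀`, degree 3**
(Bombieri–Gubler 6.5.7 with (6.12), (6.23); Davenport–Roth 1955 for one place): for `δ > 0` and `s`
there are `E = E(δ,s)` and `N₀ = N₀(δ,s)` such that for every irreducible integral binary cubic form `F`,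
every real root `α` and `p`-adic roots `θ_p` (`p ∈ S₀`, `|S₀| ≤ s`) of `F(x,1)`, the rationals `ρ` of
height `> (2·H(F))^E` ("LARGE solutions") with
`min(1,|ρ − α|) · ∏_{p∈S₀} min(1, ‖ρ − θ_p‖_p) ≤ H(ρ)^{−2−δ}` number at most `N₀`.
(B–G: large = `h(ρ) > L`, `L = m(C₁+5)ε^{−2^{m−1}}`, `C₁ = |S|(h(α)+log 2)`, `h(α) ≤ log(2H(F))`;
count `≤ (2·3·|S|)^{c₁δ^{−2}}(c₂/δ)^{|S|}`; neither depends on `F` or on the primes in `S₀`.)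
[cite: BombieriGubler2006 6.5.7, (6.12), (6.23), PDF pp.162,168–169; DavenportRoth1955] -/
def QuantRothRidout : Prop :=
  ∀ δ : ℝ, 0 < δ → ∀ s : ℕ, ∃ E : ℝ, ∃ N₀ : ℕ,
    ∀ F : BinaryCubic ℤ, F.IsIrreducible →
    ∀ (α : ℝ), Polynomial.aeval α F.toCubic.toPoly = 0 →
    ∀ (S₀ : Finset Nat.Primes), S₀.card ≤ s →
    ∀ (θ : ∀ p : Nat.Primes, @PadicAlgCl (p : ℕ) ⟨p.2⟩),
      (∀ p ∈ S₀, Polynomial.aeval (θ p) F.toCubic.toPoly = 0) →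
      {ρ : ℚ | (2 * (formHeight F : ℝ)) ^ E < ratHeight ρ ∧
          min (1 : ℝ) |(ρ : ℝ) - α| *
              (∏ p ∈ S₀, min (1 : ℝ) ‖(ρ : @PadicAlgCl (p : ℕ) ⟨p.2⟩) - θ p‖) ≤
            ratHeight ρ ^ (-(2 + δ))}.ncard ≤ N₀

/-- H4 (S/M). **The allowance pays for the target's height.** SMALL points of the index form give
polynomial Szpiro, uniformly over all totally real cubic fields: if `W` is in the class of `K`, `F` is
the reduced index form of H1 and the primitive point `P_W = (u,v)` of `W` (gen-2 dictionary:
`2⁸ Δ_min = I² |d_K|`, `I = g³ |F(u,v)|`, `g₅` squarefree with `g₅² ∣ N`) has `max(|u|,|v|) ≤ (2H(F))^E`,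
then `Δ_min ≤ 2⁻⁸ g⁶ |d_K| · 16 H(F)² (2H(F))^{6E} ≤ C · N³ · (1944 N²)^{1 + 2(1+3E)}`, by H1 and the
LANDED `resolventDiscBounds_proof`.  Stated in the form language (the curve reading is via k3's keystone
`P0` and content bound `H2`, both typed in `StubIdeas3SketchG6.lean`). -/
theorem small_points_poly (E : ℝ) (hE : 0 ≤ E) :
    ∃ Λ C : ℝ, ∀ F : BinaryCubic ℤ, 0 < F.disc → |hQ F| ≤ hP F → hP F ≤ hR F →
      ∀ u v : ℤ, (max (|u| : ℝ) (|v| : ℝ)) ≤ (2 * (formHeight F : ℝ)) ^ E →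
        |((F.eval u v : ℤ) : ℝ)| ≤ C * (F.disc : ℝ) ^ Λ := by
  sorry

/-- RUNG (target of §H; A-PS-shaped, NOT the stub). **Polynomial Szpiro on every deep-support cell of
the real `r = 0` class, off an absolutely bounded number of exceptional `j`-invariants.**  For every
`s` there are `Λ, C, N₁` such that for every totally real cubic `K` and every set `S` of at most `s`
primes there is a set `T` of at most `N₁` rationals with: every `W` in the class of `K` all of whose
DEEP primes (`v_q(Δ_min) ≥ 11`) lie in `S`, and with `j(W) ∉ T`, satisfies `Δ_min ≤ C · N^Λ`.
(`T` = the `j`-invariants of the LARGE solutions of H2 for the `≤ 3^{s+1}` root data; SMALL solutions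
obey H4; violators are solutions by H3 of the `.md`.)  Qualitative Ridout gives finiteness per `(K,S)`
with no bound; the content is the ABSOLUTE `N₁(s)` and `Λ(s)` — uniform in `K` because
`h(θ_K) ≤ log(2H(F_K)) ≪ log d_K ≪ log N`. -/
def CellPolySzpiroOffLarge : Prop :=
  ∀ s : ℕ, ∃ Λ C : ℝ, ∃ N₁ : ℕ,
    ∀ (K : Type) [Field K] [NumberField K], Module.finrank ℚ K = 3 → 0 < NumberField.discr K →
    ∀ S : Finset ℕ, S.card ≤ s → ∃ T : Finset ℚ, T.card ≤ N₁ ∧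
      ∀ (W : WeierstrassCurve ℚ) [W.IsElliptic], Irreducible W.twoTorsionPolynomial.toPoly →
        (∃ θ : K, aeval θ W.twoTorsionPolynomial.toPoly = 0) →
        (∀ q : ℕ, q.Prime → q ^ 11 ∣ W.minimalDiscriminantNorm ℤ → q ∈ S) →
        W.j ∉ T →
        (W.minimalDiscriminantNorm ℤ : ℝ) ≤ C * (W.conductorNorm ℤ : ℝ) ^ Λ

/-- Assembly of §H (M once H1–H4 and the gen-2/k3 dictionary are landed): `QuantRothRidout → CellPolySzpiroOffLarge`. -/
theorem cellPolySzpiroOffLarge_of_quantRothRidout (h : QuantRothRidout) : CellPolySzpiroOffLarge := by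
  sorry

/-- Sanity (S): the `s = 0` cell is unconditional and trivial — no deep prime at all forces
`Δ_min ∣`-type shallowness `v_q(Δ_min) ≤ 10` everywhere, so `Δ_min ≤ rad(Δ_min)^{10} ≤ (6N)^{10}`
(`primeFactors_minimalDiscriminantNorm ⊆ primeFactors_conductorNorm`). -/
theorem cell_zero_trivial :
    ∃ Λ C : ℝ, ∀ (W : WeierstrassCurve ℚ) [W.IsElliptic],
      (∀ q : ℕ, q.Prime → ¬ q ^ 11 ∣ W.minimalDiscriminantNorm ℤ) →
      (W.minimalDiscriminantNorm ℤ : ℝ) ≤ C * (W.conductorNorm ℤ : ℝ) ^ Λ := by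
  sorry

end Summit.ABC.ABC.Cruxes.IndexSzpiro.StubIdeas2RealG6
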